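import Summits.ResolutionOfSingularities.ResolutionOfSingularities.Theses.RadicialJung
import Summits.ResolutionOfSingularities.ResolutionOfSingularities.Theorems.RadicialJungCleanModelsT2CleanModelsDimLETwoOverField
import Summits.ResolutionOfSingularities.ResolutionOfSingularities.Theorems.RadicialJungCleanModelsReductionAt
import Summits.ResolutionOfSingularities.ResolutionOfSingularities.Theorems.RadicialJungCleanModelsStubStacks0BICLocus
import Summits.ResolutionOfSingularities.ResolutionOfSingularities.Theorems.RadicialJungCleanModelsCleanPatchingDefs
import Summits.ResolutionOfSingularities.ResolutionOfSingularities.Theorems.RadicialJungCleanModelsStubCleanCharts3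
import Summits.ResolutionOfSingularities.ResolutionOfSingularities.Theorems.RadicialJungCleanModelsStubCleanTwoModelPatching3
import Summits.ResolutionOfSingularities.ResolutionOfSingularities.Theorems.RadicialJungCleanModelsStubCleanGlobalization3
import Summits.ResolutionOfSingularities.ResolutionOfSingularities.Theorems.RadicialJungCleanModelsStubCleanPointBlowup
import Summits.ResolutionOfSingularities.ResolutionOfSingularities.Theorems.RadicialJungCleanModelsCleanPrincipalizationOfProp44
import Summits.ResolutionOfSingularities.ResolutionOfSingularities.Theorems.RadicialJungCleanModelsCleanCharts3ZeroDim
import Summits.ResolutionOfSingularities.ResolutionOfSingularities.Theorems.RadicialJungCleanModelsCleanLU3ArcDiscrete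
import Summits.ResolutionOfSingularities.ResolutionOfSingularities.Theorems.RadicialJungCleanModelsCleanLU3DefectlessOfThm11
import Summits.ResolutionOfSingularities.ResolutionOfSingularities.Theorems.RadicialJungCleanModelsCleanLU3CompositeCdivCPOfThm11
import Summits.ResolutionOfSingularities.ResolutionOfSingularities.Theorems.RadicialJungCleanModelsLens5PRankTwoPort5OfThm11
import Summits.ResolutionOfSingularities.ResolutionOfSingularities.Theorems.RadicialJungCleanModelsLens5TFramePDegreeC
import Summits.ResolutionOfSingularities.ResolutionOfSingularities.Theorems.RadicialJungCleanModelsLens5TFramePMonOfThm11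
import Summits.ResolutionOfSingularities.ResolutionOfSingularities.Theorems.RadicialJungCleanModelsLens5TFrameSepConst
import Summits.ResolutionOfSingularities.ResolutionOfSingularities.Theorems.RadicialJungCleanModelsLens5TFrameCompositionInfOfThm11
import Summits.ResolutionOfSingularities.ResolutionOfSingularities.Theorems.RadicialJungCleanModelsLens5PTwoPhase
import Summits.ResolutionOfSingularities.ResolutionOfSingularities.Theorems.RadicialJungCleanModelsLens5PTwoSlice
import Summits.ResolutionOfSingularities.ResolutionOfSingularities.Theorems.RadicialJungCleanModelsLens5KbarCossart
import Summits.ResolutionOfSingularities.ResolutionOfSingularities.Theorems.RadicialJungCleanModelsCcurveMainGen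
import Summits.ResolutionOfSingularities.ResolutionOfSingularities.Theorems.RadicialJungCleanModelsConeExitSmooth
import Literature.AlgebraicGeometry.Resolution.CossartFunctionNormalForm3
import Literature.AlgebraicGeometry.Resolution.TranscendenceDefect
import Literature.AlgebraicGeometry.Resolution.LocalBlowup
import Literature.AlgebraicGeometry.Resolution.ExcellentRings
import Literature.AlgebraicGeometry.Resolution.ExcellentRingsFieldProofs
import Literature.AlgebraicGeometry.CossartPiltant200819.Thm15iBaseSidePhase2019
import Literature.AlgebraicGeometry.CossartPiltant200819.GoodResolution2019
import Literature.AlgebraicGeometry.CossartPiltant200819.GoodResolutionReduced2019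
import HarnessLib

/-!
# `RadicialJung.CleanModels` from SIX inputs — the reduction of record RE-ACCOUNTED through Cossart–Piltant 2019 Thm. 1.1 (i)(ii)(iii)

Crux `stmt-ResolutionOfSingularities-15917` (`Summit.….Theses.RadicialJung.CleanModels`), line `via-clean-models`, registered skeleton
`Cruxes/CleanModels/Lines/Sketch.lean` rev 35 (sha16 de44649d8f729c3b, line lead `res-B-lead-1` g10) and the hand-1 reshape candidate
`Cruxes/CleanModels/Lines/Sketch_hand1_thm11.lean` (decomp-res-hand-1 g0, sha16 1d678993fe815a86).  Twin of
`RadicialJungCleanModelsOfInputs.lean` (lead g9, Sketch rev 33: SEVEN inputs, four of them printed — F-32 `CossartJannsenSaito2020Embedded`,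
F-02 `CossartPiltant2019`, F-112 `Cossart1987Thm`, wi-91399 `CossartPiltant2019_thm_1_5_i_baseSidePhase`).

What this file records, as kernel-checked theorems with NO `sorry` and NO new definition: the SAME composition with the seven stubs of the
registered rev-35 skeleton turned into hypotheses, EXCEPT that the two printed inputs F-32 (Cossart–Jannsen–Saito 2020 Thm. 1.4, `B = ∅`) and
F-02 (Cossart–Piltant 2019 Thm. 1.1 (i)(ii), finite type over a field) are REPLACED by ONE printed input, the tree's VERBATIM typing of
Cossart–Piltant 2019 Thm. 1.1 with all three conclusions, `CP2019.CossartPiltant2019Thm11` (`Literature/…/CossartPiltant200819/GoodResolution2019.lean`).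
Every former use of F-32 in the dimension-3 slice was the embedded-resolution shape `hEmb` (CJS Cor. 1.5) for a HYPERSURFACE `V(x) ⊂ Spec R`
with `R` an excellent regular domain of dimension `≤ 3`; that shape is a THEOREM over `CossartPiltant2019Thm11` by the doubling trick
(✓ `Doubling.hEmb_zeroLocus_of_thm11`, `RadicialJungCleanModelsDoublingHEmb.lean`: Thm. 1.1 (iii) on the reduced excellent threefold
`Spec R[t]/(t² − x t)`, whose singular locus is exactly `V(x)`), and every consumer has a landed `_thm11` twin (decomp-res-hand-1 g0,
p789446 … p790504); F-02 is the tree's PROVED corollary `CP2019.CossartPiltant2019Thm11.cossartPiltant2019` (with `Stacks07QW_field_holds`).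

* `cleanLU3DefectNonDiscrete_of_inputs`, `cleanLU3_of_inputs`, `cleanModels_dimLEThree_of_inputs`, `cleanModels_of_inputs` — the four
  nodes of the twin file, with `CP2019.CossartPiltant2019Thm11` in place of F-32/F-02 (every consumer replaced by its landed `_thm11` twin,
  F-02 derived inside the proofs), the registered rev-35 research statement `hB` (= `stub_cleanLU3DefectNonDiscrete`, smooth-cone binder
  included, VERBATIM; one more `by_cases` closed by ✓ `ConeExit.cleanLUConcl_of_smoothCone`), the registered printed stub `hBS2`
  (= `stub_cp2019Thm15iBaseSidePhaseTwo`, the `p = 2` INSTANCE of wi-91399, VERBATIM, through ✓ `Lens5.PTwo.cleanLU3_of_eq_two_of_phaseTwo`),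
  `h44c` (= `stub_cleanProp44`, VERBATIM) and `hGE4` (= `stub_cleanModelsDimGEFour`, VERBATIM);
* `cleanModels_of_namedInputs` — the same with `hBS2` supplied by the general-`p` NAMED fact wi-91399 (✓ `Lens5.PTwo.baseSidePhaseTwo_of_cp2019`):
  the crux from THREE NAMED PRINTED FACTS {`CP2019.CossartPiltant2019Thm11`, `Cossart1987Thm`, `CossartPiltant2019_thm_1_5_i_baseSidePhase`} and
  three unproved statements of ours;
* `cleanModels_of_general_cjs_inputs` — book-keeping in the other direction: the printed base did not GROW, since the tree PROVES
  `CP2019.thm11_of_general : CossartPiltant2019General → CossartJannsenSaito2020Embedded → CossartPiltant2019Thm11`.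

INPUT LEDGER of the dimension-3 slice, as kernel-checked here: PRINTED = `CP2019.CossartPiltant2019Thm11` (CP 2019 Thm. 1.1 (i)(ii)(iii) verbatim) ·
F-112 `Cossart1987Thm` (Cossart 1987 via Posva 2024 App. A, `k = k̄`) · wi-91399 at `p = 2` (CP 2019 Thm. 1.5 (i), base-side `m = p` phase); RESEARCH
(OURS) = `hB` (class (B)) · `h44c` (X44c); FRONTIER = `hGE4` (`dim W ≥ 4`).  Nothing else.  Honest framing: a CONDITIONAL packaging (re-accounting of
NAMED inputs through a kernel engine — the printed proof of CP 2019 Thm. 1.1 itself cites CJS 2020); it proves nothing about resolution of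
singularities in characteristic `p`; `CleanModels` in `dim ≥ 3` is unsettled.
-/

noncomputable section

set_option linter.dupNamespace false

open CategoryTheory AlgebraicGeometry
open Literature.AlgebraicGeometry.Resolution Literature.AlgebraicGeometry.Motives
open Literature.AlgebraicGeometry.CossartPiltant200819

namespace Summit.ResolutionOfSingularities.ResolutionOfSingularities.Theorems.RadicialJung.CleanModels.OfInputsThm11

section Inputs

variable
  -- PRINTED F-112: Cossart 1987 (`k = k̄`); the printed `h11 : CP2019.CossartPiltant2019Thm11` is an EXPLICIT binder of each theorem.
  (h112 : Cossart1987Thm)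
  -- PRINTED wi-91399 AT `p = 2`: `stub_cp2019Thm15iBaseSidePhaseTwo` of Sketch rev 33–35, VERBATIM. [cite: CossartPiltant2019, Thm. 1.5 (i)]
  (hBS2 :
    ∀ (S : Type) [CommRing S] [IsRegularLocalRing S],
      IsExcellentRing S → ringKrullDim S = 3 → CharP S 2 →
      ∀ (K : Type) [Field K] [Algebra S K] [IsFractionRing S K] (f : S),
      (∀ c : K, c ^ 2 ≠ algebraMap S K f) →
      ∀ (O : ValuationSubring K), (algebraMap S K).range ≤ O.toSubring →
      (∀ s ∈ IsLocalRing.maximalIdeal S, O.valuation (algebraMap S K s) < 1) →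
      ∃ (n : ℕ) (B : ℕ → Subring K) (g : ℕ → K),
      B 0 = locAtCentre (algebraMap S K).range O ∧ g 0 = algebraMap S K f ∧
      (∀ i ≤ n, B i ≤ O.toSubring ∧ IsRegularLocalRing (B i) ∧ g i ∈ B i) ∧
      (∀ i < n, ∃ P : Ideal (B i), IsRegularLocalRing ((B i) ⧸ P) ∧
        IsLocalBlowupAlong O (B i) P (B (i + 1)) ∧
        ∃ c d : K, c ≠ 0 ∧ g (i + 1) = c ^ 2 * g i + d ^ 2) ∧
      ∀ (hg : g n ∈ B n) (_hBn : IsRegularLocalRing (B n)) (c : B n),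
        (⟨g n, hg⟩ : B n) - c ^ 2 ∉ IsLocalRing.maximalIdeal (B n) ^ 2)
  -- RESEARCH (OURS), class (B): `stub_cleanLU3DefectNonDiscrete` of Sketch rev 35, VERBATIM.
  (hB :
    ∀ (p : ℕ), p.Prime → p ≠ 2 →
    ∀ (k : Type) [Field k] [CharP k p] (K : Type) [Field K] [Algebra k K]
    (O : ValuationSubring K) (A : Subalgebra k K), A.toSubring ≤ O.toSubring → A.FG → IsFractionRing A K →
    ringKrullDim A ≤ 3 → IsRegularLocalRing (locAtCentre A.toSubring O) →
    ringKrullDim (locAtCentre A.toSubring O) = 3 →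
    (∀ (T : Subring K) (hT : T ≤ O.toSubring), A.toSubring ≤ T → (subringCentre T O hT).IsMaximal) →
    ∀ g₀ : K, (∀ c : K, c ^ p ≠ g₀) →
    (∀ f₀ : K, ∃ f₁ : K, O.valuation (g₀ - f₁ ^ p) < O.valuation (g₀ - f₀ ^ p)) →
    (∀ hk : ∀ c : k, algebraMap k K c ∈ O, transcendenceDefect k O hk ≠ 0) →
    ¬ (∃ π : K, π ≠ 0 ∧ (∀ x : K, O.valuation x < 1 → O.valuation x ≤ O.valuation π) ∧
      (∀ x : K, x ≠ 0 → ∃ n : ℕ, O.valuation π ^ n ≤ O.valuation x)) →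
    ¬ (∃ (O₁ : ValuationSubring K), O ≤ O₁ ∧ O₁ ≠ ⊤ ∧ ∃ y : Fin 2 → K, (∀ i, y i ∈ O) ∧
      ∀ P : MvPolynomial (Fin 2) k, P ≠ 0 → O₁.valuation (MvPolynomial.aeval y P) = 1) →
    ¬ ((∃ x y : K, x ≠ 0 ∧ y ≠ 0 ∧ ∀ a b : ℕ, a < p → b < p → (a ≠ 0 ∨ b ≠ 0) →
        ∀ z : K, z ≠ 0 → O.valuation (x ^ a * y ^ b) ≠ O.valuation (z ^ p)) ∧
      ∃ r : ℕ, Module.finrank (Subfield.closure (Set.range (fun x : k => x ^ p))) k = p ^ r ∧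
        Module.finrank (Subfield.closure (Set.range (fun x : IsLocalRing.ResidueField O => x ^ p))) (IsLocalRing.ResidueField O) = p ^ r) →
    ¬ ((∃ x y : K, x ≠ 0 ∧ y ≠ 0 ∧ ∀ a b : ℕ, a < p → b < p → (a ≠ 0 ∨ b ≠ 0) →
        ∀ z : K, z ≠ 0 → O.valuation (x ^ a * y ^ b) ≠ O.valuation (z ^ p)) ∧
      ∃ k' : IntermediateField k K, FiniteDimensional k k' ∧
        (∃ (n : ℕ) (s : Fin n → K), AlgebraicIndependent k' s ∧ Algebra.IsSeparable (IntermediateField.adjoin k' (Set.range s)) K) ∧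
        ∃ _ : Algebra k' (IsLocalRing.ResidueField O),
          (∀ (c : k') (h : algebraMap k' K c ∈ O),
            algebraMap k' (IsLocalRing.ResidueField O) c = IsLocalRing.residue O ⟨algebraMap k' K c, h⟩) ∧
          Algebra.IsSeparable k' (IsLocalRing.ResidueField O)) →
    ¬ IsAlgClosed k →
    ¬ (∃ O₁ : ValuationSubring K, O ≤ O₁ ∧ O₁ ≠ O ∧ O₁ ≠ ⊤) →
    ¬ (∃ (A' : Subalgebra k K) (_ : A'.toSubring ≤ O.toSubring) (_ : A ≤ A') (_ : A'.FG)
        (_ : IsRegularLocalRing (locAtCentre A'.toSubring O)) (c : Fin p → K) (_ : ∃ j : Fin p, (j : ℕ) ≠ 0 ∧ c j ≠ 0)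
        (h : ↥(locAtCentre A'.toSubring O)) (_ : (∑ j : Fin p, c j ^ p * g₀ ^ (j : ℕ)) = (h : K))
        (d : ℕ) (_ : 0 < d) (_ : (IsLocalRing.maximalIdeal ↥(locAtCentre A'.toSubring O)).spanFinrank = d)
        (t : Fin d → ↥(locAtCentre A'.toSubring O)) (_ : Ideal.span (Set.range t) = IsLocalRing.maximalIdeal ↥(locAtCentre A'.toSubring O))
        (F : MvPolynomial (Fin d) ↥(locAtCentre A'.toSubring O)) (e N : ℕ) (_ : F.IsHomogeneous e) (_ : ¬ p ∣ e) (_ : e ≤ N + 1),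
        h - MvPolynomial.aeval t F ∈ IsLocalRing.maximalIdeal ↥(locAtCentre A'.toSubring O) ^ (e + 1) ∧
        ∀ i, ∃ b : Fin d → ↥(locAtCentre A'.toSubring O),
          (∀ l, b l ∈ IsLocalRing.maximalIdeal ↥(locAtCentre A'.toSubring O) ^ (N + 1 - e)) ∧
          t i ^ N - ∑ l, b l * MvPolynomial.aeval t (MvPolynomial.pderiv l F) ∈
            IsLocalRing.maximalIdeal ↥(locAtCentre A'.toSubring O) ^ (N + 1)) →
    ∃ (A' : Subalgebra k K), A'.toSubring ≤ O.toSubring ∧ A ≤ A' ∧ A'.FG ∧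
    ∃ (_ : IsRegularLocalRing (locAtCentre A'.toSubring O)) (c : Fin p → K), (∃ j : Fin p, (j : ℕ) ≠ 0 ∧ c j ≠ 0) ∧
    ((∃ (d m : ℕ) (hmd : m ≤ d) (t : Fin d → ↥(locAtCentre A'.toSubring O)) (a : Fin m → ℕ) (u : ↥(locAtCentre A'.toSubring O)), IsUnit u ∧
    Ideal.span (Set.range t) = IsLocalRing.maximalIdeal ↥(locAtCentre A'.toSubring O) ∧
    ringKrullDim ↥(locAtCentre A'.toSubring O) = (d : WithBot ℕ∞) ∧ 0 < m ∧ (∀ i, ¬ p ∣ a i) ∧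
    (∑ j : Fin p, c j ^ p * g₀ ^ (j : ℕ)) = (u : K) * ∏ i : Fin m, ((t (Fin.castLE hmd i) : ↥(locAtCentre A'.toSubring O)) : K) ^ (a i)) ∨
    (∃ u : ↥(locAtCentre A'.toSubring O), IsUnit u ∧ (∑ j : Fin p, c j ^ p * g₀ ^ (j : ℕ)) = (u : K) ∧
    ∀ c' : ↥(locAtCentre A'.toSubring O), u - c' ^ p ∉ IsLocalRing.maximalIdeal ↥(locAtCentre A'.toSubring O)) ∨
    (∃ s c' : ↥(locAtCentre A'.toSubring O), (∑ j : Fin p, c j ^ p * g₀ ^ (j : ℕ)) = (s : K) ∧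
    s - c' ^ p ∈ IsLocalRing.maximalIdeal ↥(locAtCentre A'.toSubring O) ∧
    s - c' ^ p ∉ IsLocalRing.maximalIdeal ↥(locAtCentre A'.toSubring O) ^ 2)))
  (h44c :
    ∀ (p : ℕ), p.Prime → ∀ (S : Scheme.{0}) [IsIntegral S] [IsNoetherian S],
      CharP S.functionField p → Scheme.IsRegular S → Scheme.IsExcellent S → topologicalKrullDim S = 3 →
      ∀ G₀ : S.functionField, (∀ s : S, CleanRegAt p (algebraMap (S.presheaf.stalk s) S.functionField) G₀) →
      ∀ I : S.IdealSheafData, I ≠ ⊥ →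
      ∀ (X : Scheme.{0}) (ρ : X ⟶ S) [IsIntegral X] [IsNoetherian X] [IsDominant ρ],
        IsCleanRegularCentreBlowupSeq p ρ I G₀ →
        (∀ x : X, CleanRegAt p (algebraMap (X.presheaf.stalk x) X.functionField) (RatFn.functionFieldMap ρ G₀)) →
        ∀ (J : X.IdealSheafData) (μ : ℕ), 1 ≤ μ →
          (∀ x ∈ J.support, 1 < Order.coheight x) → (∀ x, idealOrder J x ≤ μ) → (∃ x, idealOrder J x = μ) →
          ∃ (X' : Scheme.{0}) (π : X' ⟶ X) (_ : IsIntegral X') (_ : IsDominant π) (J' : X'.IdealSheafData),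
            IsCleanPermissibleSeq p π J μ J' (RatFn.functionFieldMap ρ G₀) ∧ ∀ x, idealOrder J' x < μ)
  -- FRONTIER (rung-B PRICE): `stub_cleanModelsDimGEFour`, VERBATIM (`dim W ≥ 4`).
  (hGE4 :
      ∀ p : ℕ, p.Prime → ∀ (k : Type) [Field k] [CharP k p] (W : AlgebraicGeometry.Scheme.{0})
      [AlgebraicGeometry.IsIntegral W] (f : W ⟶ AlgebraicGeometry.Spec (.of k)) (L : Type) [Field L] [Algebra
      W.functionField L], AlgebraicGeometry.IsSeparated f → AlgebraicGeometry.LocallyOfFiniteType f →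
      AlgebraicGeometry.QuasiCompact f → Literature.AlgebraicGeometry.Resolution.Scheme.IsRegular W →
      IsPurelyInseparable W.functionField L → Module.finrank W.functionField L = p → ¬ topologicalKrullDim W ≤ 3 → ∃
      (V : AlgebraicGeometry.Scheme.{0}) (π : V ⟶ W) (_ : AlgebraicGeometry.IsIntegral V) (_ :
      AlgebraicGeometry.IsDominant π), AlgebraicGeometry.IsProper π ∧
      Literature.AlgebraicGeometry.Resolution.IsBirational π ∧
      Literature.AlgebraicGeometry.Resolution.Scheme.IsRegular V ∧ (∀ v : V, (∃ (y : L) (g : W.functionField), y ∉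
      Set.range (algebraMap W.functionField L) ∧ algebraMap W.functionField L g = y ^ p ∧ ((∃ (d m : ℕ) (hmd : m ≤ d)
      (t : Fin d → V.presheaf.stalk v) (a : Fin m → ℕ), Ideal.span (Set.range t) = IsLocalRing.maximalIdeal
      (V.presheaf.stalk v) ∧ ringKrullDim (V.presheaf.stalk v) = (d : WithBot ℕ∞) ∧ 0 < m ∧ (∀ i, ¬ p ∣ a i) ∧
      Literature.AlgebraicGeometry.Motives.RatFn.functionFieldMap π g = ∏ i : Fin m, (algebraMap (V.presheaf.stalk v)
      V.functionField (t (Fin.castLE hmd i))) ^ (a i)) ∨ (∃ u₀ : V.presheaf.stalk v, IsUnit u₀ ∧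
      Literature.AlgebraicGeometry.Motives.RatFn.functionFieldMap π g = algebraMap (V.presheaf.stalk v)
      V.functionField u₀ ∧ ((∀ c : V.presheaf.stalk v, u₀ - c ^ p ∉ IsLocalRing.maximalIdeal (V.presheaf.stalk v)) ∨
      (∃ c : V.presheaf.stalk v, u₀ - c ^ p ∈ IsLocalRing.maximalIdeal (V.presheaf.stalk v) ∧ u₀ - c ^ p ∉
      IsLocalRing.maximalIdeal (V.presheaf.stalk v) ^ 2)))))))

include h112 hB in
/-- The rev-20/24 node «clean LU at ZERO-DIMENSIONAL, NON-ABHYANKAR valuations where the line of `g₀` is IMMEDIATE and `O` is NOT discrete of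
rank one», for ODD `p`, from the printed facts `CP2019.CossartPiltant2019Thm11` / F-112 and the class-(B) research statement `hB` (rev 35), by
excluded middle on «divisorial coarsening» ((C-div) slice, ✓ `cleanLU3Defect_of_divisorialCoarsening_cp_thm11`), «`k` perfect and `[Γ:pΓ] = p²`»
(THEOREM T, ✓ `…cleanLU3DefectPRankTwo_of_cossartPiltant2019_thm11`), «`[Γ:pΓ] = p²` and equal finite `p`-degrees» (T⁗‴), «`[Γ:pΓ] = p²` and
separable constants» (T″/T‴), «`k` algebraically closed» (F-112), «proper coarsening» (composite slice), «a smooth-cone stage exists» (✓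
`ConeExit.cleanLUConcl_of_smoothCone`).  F-02 is derived: `CP2019.CossartPiltant2019Thm11.cossartPiltant2019 h11 Stacks07QW_field_holds`.
Composition identical to `cleanLU3DefectNonDiscrete_of_stubs` of `Lines/Sketch_hand1_thm11.lean`. [cite: CossartPiltant2019, Thm. 1.1] -/
theorem cleanLU3DefectNonDiscrete_of_inputs (h11 : CP2019.CossartPiltant2019Thm11.{0}) :
    ∀ (p : ℕ), p.Prime → p ≠ 2 →
    ∀ (k : Type) [Field k] [CharP k p] (K : Type) [Field K] [Algebra k K]
    (O : ValuationSubring K) (A : Subalgebra k K), A.toSubring ≤ O.toSubring → A.FG → IsFractionRing A K →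
    ringKrullDim A ≤ 3 → IsRegularLocalRing (locAtCentre A.toSubring O) →
    ringKrullDim (locAtCentre A.toSubring O) = 3 →
    (∀ (T : Subring K) (hT : T ≤ O.toSubring), A.toSubring ≤ T → (subringCentre T O hT).IsMaximal) →
    ∀ g₀ : K, (∀ c : K, c ^ p ≠ g₀) →
    (∀ f₀ : K, ∃ f₁ : K, O.valuation (g₀ - f₁ ^ p) < O.valuation (g₀ - f₀ ^ p)) →
    (∀ hk : ∀ c : k, algebraMap k K c ∈ O, transcendenceDefect k O hk ≠ 0) →
    ¬ (∃ π : K, π ≠ 0 ∧ (∀ x : K, O.valuation x < 1 → O.valuation x ≤ O.valuation π) ∧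
      (∀ x : K, x ≠ 0 → ∃ n : ℕ, O.valuation π ^ n ≤ O.valuation x)) →
    ∃ (A' : Subalgebra k K), A'.toSubring ≤ O.toSubring ∧ A ≤ A' ∧ A'.FG ∧
    ∃ (_ : IsRegularLocalRing (locAtCentre A'.toSubring O)) (c : Fin p → K), (∃ j : Fin p, (j : ℕ) ≠ 0 ∧ c j ≠ 0) ∧
    ((∃ (d m : ℕ) (hmd : m ≤ d) (t : Fin d → ↥(locAtCentre A'.toSubring O)) (a : Fin m → ℕ) (u : ↥(locAtCentre A'.toSubring O)), IsUnit u ∧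
    Ideal.span (Set.range t) = IsLocalRing.maximalIdeal ↥(locAtCentre A'.toSubring O) ∧
    ringKrullDim ↥(locAtCentre A'.toSubring O) = (d : WithBot ℕ∞) ∧ 0 < m ∧ (∀ i, ¬ p ∣ a i) ∧
    (∑ j : Fin p, c j ^ p * g₀ ^ (j : ℕ)) = (u : K) * ∏ i : Fin m, ((t (Fin.castLE hmd i) : ↥(locAtCentre A'.toSubring O)) : K) ^ (a i)) ∨
    (∃ u : ↥(locAtCentre A'.toSubring O), IsUnit u ∧ (∑ j : Fin p, c j ^ p * g₀ ^ (j : ℕ)) = (u : K) ∧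
    ∀ c' : ↥(locAtCentre A'.toSubring O), u - c' ^ p ∉ IsLocalRing.maximalIdeal ↥(locAtCentre A'.toSubring O)) ∨
    (∃ s c' : ↥(locAtCentre A'.toSubring O), (∑ j : Fin p, c j ^ p * g₀ ^ (j : ℕ)) = (s : K) ∧
    s - c' ^ p ∈ IsLocalRing.maximalIdeal ↥(locAtCentre A'.toSubring O) ∧
    s - c' ^ p ∉ IsLocalRing.maximalIdeal ↥(locAtCentre A'.toSubring O) ^ 2)) := by
  intro p hp hp2 k _ _ K _ _ O A hAO hAfg hfrac hdimA hreg hdim3 hzd g₀ hg₀ hdefect htd hdisc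
  have h02 : CossartPiltant2019.{0} := CP2019.CossartPiltant2019Thm11.cossartPiltant2019 h11 Stacks07QW_field_holds
  by_cases hdiv : ∃ (O₁ : ValuationSubring K), O ≤ O₁ ∧ O₁ ≠ ⊤ ∧ ∃ y : Fin 2 → K, (∀ i, y i ∈ O) ∧
      ∀ P : MvPolynomial (Fin 2) k, P ≠ 0 → O₁.valuation (MvPolynomial.aeval y P) = 1
  · obtain ⟨O₁, hOO₁, hO₁, y, hy, hind⟩ := hdiv
    exact cleanLU3Defect_of_divisorialCoarsening_cp_thm11 h11 h02 p hp k K O A hAO hAfg hfrac hdim3 hzd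
      g₀ hg₀ hdefect O₁ hOO₁ hO₁ y hy hind
  · by_cases hT : PerfectField k ∧ ∃ x y : K, x ≠ 0 ∧ y ≠ 0 ∧ ∀ a b : ℕ, a < p → b < p → (a ≠ 0 ∨ b ≠ 0) →
        ∀ z : K, z ≠ 0 → O.valuation (x ^ a * y ^ b) ≠ O.valuation (z ^ p)
    · obtain ⟨hperf, hP2⟩ := hT
      haveI := hperf
      haveI : Fact p.Prime := ⟨hp⟩
      exact Lens5.PRankTwoAssembly.cleanLU3DefectPRankTwo_of_cossartPiltant2019_thm11 p h02 h11
        k K O A hAO hAfg hfrac hdimA hreg hdim3 hzd g₀ hg₀ hdefect htd hdisc hP2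
    · by_cases hT4 : (∃ x y : K, x ≠ 0 ∧ y ≠ 0 ∧ ∀ a b : ℕ, a < p → b < p → (a ≠ 0 ∨ b ≠ 0) →
          ∀ z : K, z ≠ 0 → O.valuation (x ^ a * y ^ b) ≠ O.valuation (z ^ p)) ∧
        ∃ r : ℕ, Module.finrank (Subfield.closure (Set.range (fun x : k => x ^ p))) k = p ^ r ∧
          Module.finrank (Subfield.closure (Set.range (fun x : IsLocalRing.ResidueField O => x ^ p))) (IsLocalRing.ResidueField O) = p ^ r
      · obtain ⟨hP2, r, hk, hκ⟩ := hT4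
        haveI : Fact p.Prime := ⟨hp⟩
        exact Summit.ResolutionOfSingularities.ResolutionOfSingularities.Theorems.RadicialJungCleanModels.Lens5TFrame.cleanLU3DefectPRankTwoPDeg_of_pMon p
          (Summit.ResolutionOfSingularities.ResolutionOfSingularities.Theorems.RadicialJungCleanModels.Lens5TFrame.cleanLU3DefectPRankTwoPMon_of_cossartPiltant2019_thm11
            p h02 h11)
          k K O A hAO hAfg hfrac hdimA hreg hdim3 hzd g₀ hg₀ hdefect htd hdisc hP2 r hk hκ
      · by_cases hT6 : (∃ x y : K, x ≠ 0 ∧ y ≠ 0 ∧ ∀ a b : ℕ, a < p → b < p → (a ≠ 0 ∨ b ≠ 0) →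
            ∀ z : K, z ≠ 0 → O.valuation (x ^ a * y ^ b) ≠ O.valuation (z ^ p)) ∧
          ∃ k' : IntermediateField k K, FiniteDimensional k k' ∧
            (∃ (n : ℕ) (s : Fin n → K), AlgebraicIndependent k' s ∧ Algebra.IsSeparable (IntermediateField.adjoin k' (Set.range s)) K) ∧
            ∃ _ : Algebra k' (IsLocalRing.ResidueField O),
              (∀ (c : k') (h : algebraMap k' K c ∈ O),
                algebraMap k' (IsLocalRing.ResidueField O) c = IsLocalRing.residue O ⟨algebraMap k' K c, h⟩) ∧
              Algebra.IsSeparable k' (IsLocalRing.ResidueField O)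
        · haveI : Fact p.Prime := ⟨hp⟩
          exact Summit.ResolutionOfSingularities.ResolutionOfSingularities.Theorems.RadicialJungCleanModels.Lens5TFrame.cleanLUConcl_of_sepConst p
            (Summit.ResolutionOfSingularities.ResolutionOfSingularities.Theorems.RadicialJungCleanModels.Lens5TFrame.cleanLU3DefectPRankTwoSepConst_of_cossartPiltant2019 p h02
              (Summit.ResolutionOfSingularities.ResolutionOfSingularities.Theorems.RadicialJungCleanModels.Lens5TFrame.cleanLU3DefectPRankTwoSepRes_of_cossartPiltant2019_thm11 p h02
                h11))
            k K O A hAO hAfg hfrac hdimA hreg hdim3 hzd g₀ hg₀ hdefect htd hdisc hT6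
        · by_cases halg : IsAlgClosed k
          · exact Lens5.KbarCossart.cleanLU3DefectNonDiscrete_algClosed_of_cossart1987Thm p h112 hp k K O A hAO hAfg
              hfrac hdimA hreg hdim3 hzd g₀ hg₀ hdefect htd hdisc hdiv hT
          · by_cases hCc : ∃ O₁ : ValuationSubring K, O ≤ O₁ ∧ O₁ ≠ O ∧ O₁ ≠ ⊤
            · obtain ⟨O₁, hOO₁, hne, hO₁⟩ := hCc
              exact Ccurve.cleanLU3Defect_of_properCoarsening h02 p hp k K O A hAO hAfg hfrac hdimA hreg hdim3 hzd
                g₀ hg₀ hdiv O₁ hOO₁ hne hO₁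
            · by_cases hSmooth : ∃ (A' : Subalgebra k K) (_ : A'.toSubring ≤ O.toSubring) (_ : A ≤ A') (_ : A'.FG)
                  (_ : IsRegularLocalRing (locAtCentre A'.toSubring O)) (c : Fin p → K) (_ : ∃ j : Fin p, (j : ℕ) ≠ 0 ∧ c j ≠ 0)
                  (h : ↥(locAtCentre A'.toSubring O)) (_ : (∑ j : Fin p, c j ^ p * g₀ ^ (j : ℕ)) = (h : K))
                  (d : ℕ) (_ : 0 < d) (_ : (IsLocalRing.maximalIdeal ↥(locAtCentre A'.toSubring O)).spanFinrank = d)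
                  (t : Fin d → ↥(locAtCentre A'.toSubring O))
                  (_ : Ideal.span (Set.range t) = IsLocalRing.maximalIdeal ↥(locAtCentre A'.toSubring O))
                  (F : MvPolynomial (Fin d) ↥(locAtCentre A'.toSubring O)) (e N : ℕ) (_ : F.IsHomogeneous e) (_ : ¬ p ∣ e) (_ : e ≤ N + 1),
                  h - MvPolynomial.aeval t F ∈ IsLocalRing.maximalIdeal ↥(locAtCentre A'.toSubring O) ^ (e + 1) ∧
                  ∀ i, ∃ b : Fin d → ↥(locAtCentre A'.toSubring O),
                    (∀ l, b l ∈ IsLocalRing.maximalIdeal ↥(locAtCentre A'.toSubring O) ^ (N + 1 - e)) ∧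
                    t i ^ N - ∑ l, b l * MvPolynomial.aeval t (MvPolynomial.pderiv l F) ∈
                      IsLocalRing.maximalIdeal ↥(locAtCentre A'.toSubring O) ^ (N + 1)
              · obtain ⟨A', hA'O, hAA', hA'fg, hregA', c, hc0, h, hc, d, hd0, hd, t, ht, F, e, N, hF, hpe, hN, hQ, hsm⟩ := hSmooth
                exact ConeExit.cleanLUConcl_of_smoothCone hp O A A' hA'O hAA' hA'fg hregA' g₀ c hc0 h hc hd0 hd t ht F hF hpe hQ hN hsm
              · exact hB p hp hp2 k K O A hAO hAfg hfrac hdimA hreg hdim3 hzd g₀ hg₀ hdefect htd hdisc hdiv hT4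
                  hT6 halg hCc hSmooth

include h112 hBS2 hB in
/-- **Clean local uniformization at ZERO-DIMENSIONAL valuation rings with a 3-dimensional regular centre** (the hypothesis `hLU` of the landed
4a variant ✓ `cleanCharts3_of_cleanLU3ZeroDim`), every prime `p`: `p = 2` from the registered printed stub `hBS2` ALONE (✓
`Lens5.PTwo.cleanLU3_of_eq_two_of_phaseTwo`); for odd `p`, excluded middle on «best `p`-th-power approximation» (defectless half ✓
`cleanLU3_of_isMin_pthPowerApprox_of_thm11`), «transcendence defect `= 0`» (Abhyankar, ✓ `cleanLU3_of_transcendenceDefect_eq_zero_of_thm11`),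
«discrete rank one» (class (A), ✓ `cleanLU3DefectArc_of_discrete`), then the previous theorem.  Composition identical to
`cleanLU3_of_stubs ∘ cleanLU3Defect_of_stubs` of `Lines/Sketch_hand1_thm11.lean`. [cite: CossartPiltant2019, Thm. 1.1 and Thm. 1.5 (i)] -/
theorem cleanLU3_of_inputs (h11 : CP2019.CossartPiltant2019Thm11.{0}) :
    ∀ (p : ℕ), p.Prime →
    ∀ (k : Type) [Field k] [CharP k p] (K : Type) [Field K] [Algebra k K]
    (O : ValuationSubring K) (A : Subalgebra k K), A.toSubring ≤ O.toSubring → A.FG → IsFractionRing A K →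
    ringKrullDim A ≤ 3 → IsRegularLocalRing (locAtCentre A.toSubring O) →
    ringKrullDim (locAtCentre A.toSubring O) = 3 →
    (∀ (T : Subring K) (hT : T ≤ O.toSubring), A.toSubring ≤ T → (subringCentre T O hT).IsMaximal) →
    ∀ g₀ : K, (∀ c : K, c ^ p ≠ g₀) →
    ∃ (A' : Subalgebra k K), A'.toSubring ≤ O.toSubring ∧ A ≤ A' ∧ A'.FG ∧
    ∃ (_ : IsRegularLocalRing (locAtCentre A'.toSubring O)) (c : Fin p → K), (∃ j : Fin p, (j : ℕ) ≠ 0 ∧ c j ≠ 0) ∧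
    ((∃ (d m : ℕ) (hmd : m ≤ d) (t : Fin d → ↥(locAtCentre A'.toSubring O)) (a : Fin m → ℕ) (u : ↥(locAtCentre A'.toSubring O)), IsUnit u ∧
    Ideal.span (Set.range t) = IsLocalRing.maximalIdeal ↥(locAtCentre A'.toSubring O) ∧
    ringKrullDim ↥(locAtCentre A'.toSubring O) = (d : WithBot ℕ∞) ∧ 0 < m ∧ (∀ i, ¬ p ∣ a i) ∧
    (∑ j : Fin p, c j ^ p * g₀ ^ (j : ℕ)) = (u : K) * ∏ i : Fin m, ((t (Fin.castLE hmd i) : ↥(locAtCentre A'.toSubring O)) : K) ^ (a i)) ∨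
    (∃ u : ↥(locAtCentre A'.toSubring O), IsUnit u ∧ (∑ j : Fin p, c j ^ p * g₀ ^ (j : ℕ)) = (u : K) ∧
    ∀ c' : ↥(locAtCentre A'.toSubring O), u - c' ^ p ∉ IsLocalRing.maximalIdeal ↥(locAtCentre A'.toSubring O)) ∨
    (∃ s c' : ↥(locAtCentre A'.toSubring O), (∑ j : Fin p, c j ^ p * g₀ ^ (j : ℕ)) = (s : K) ∧
    s - c' ^ p ∈ IsLocalRing.maximalIdeal ↥(locAtCentre A'.toSubring O) ∧
    s - c' ^ p ∉ IsLocalRing.maximalIdeal ↥(locAtCentre A'.toSubring O) ^ 2)) := by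
  intro p hp k _ _ K _ _ O A hAO hAfg hfrac hdimA hreg hdim3 hzd g₀ hg₀
  by_cases hp2 : p = 2
  · exact Lens5.PTwo.cleanLU3_of_eq_two_of_phaseTwo hBS2 p hp hp2 k K O A hAO hAfg hfrac hdimA hreg hdim3 hzd g₀ hg₀
  by_cases hbest : ∃ f₀ : K, ∀ f : K, O.valuation (g₀ - f₀ ^ p) ≤ O.valuation (g₀ - f ^ p)
  · obtain ⟨f₀, hf₀⟩ := hbest
    exact cleanLU3_of_isMin_pthPowerApprox_of_thm11 h11 p hp k K O A hAO hAfg hfrac hreg hdim3 g₀ hg₀ f₀ hf₀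
  · push Not at hbest
    have hk : ∀ c : k, algebraMap k K c ∈ O := fun c => hAO (A.algebraMap_mem c)
    by_cases htd : transcendenceDefect k O hk = 0
    · exact cleanLU3_of_transcendenceDefect_eq_zero_of_thm11 h11 p hp k K O A hAO hAfg hfrac hreg hdim3 g₀ hg₀ hk htd
    · have htd' : ∀ hk' : ∀ c : k, algebraMap k K c ∈ O, transcendenceDefect k O hk' ≠ 0 :=
        fun hk' => (by exact htd : transcendenceDefect k O hk ≠ 0)
      by_cases hdisc : (∃ π : K, π ≠ 0 ∧ (∀ x : K, O.valuation x < 1 → O.valuation x ≤ O.valuation π) ∧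
          (∀ x : K, x ≠ 0 → ∃ n : ℕ, O.valuation π ^ n ≤ O.valuation x))
      · exact cleanLU3DefectArc_of_discrete p hp k K O A hAO hAfg hfrac hdimA hreg hdim3 hzd g₀ hg₀ hbest htd' hdisc
      · exact cleanLU3DefectNonDiscrete_of_inputs (h112 := h112) (hB := hB) (h11 := h11) p hp hp2 k K O A hAO hAfg hfrac hdimA hreg hdim3 hzd g₀
          hg₀ hbest htd' hdisc

include h112 hBS2 hB h44c in
/-- **The crux `RadicialJung.CleanModels` RESTRICTED TO `dim W ≤ 3`** from the three printed inputs `CP2019.CossartPiltant2019Thm11` / F-112 /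
wi-91399 at `p = 2` and the two research statements `hB` (class (B)) and `h44c` (X44c): `dim W ≤ 2` by F-75c (✓ `stub_stacks0BICLocus`, ✓
`cleanModels_dimLETwo_of_f75c`); `dim W = 3` by the landed patching chain for clean pairs — ✓ `stub_cleanGlobalization3` over ✓
`cleanCharts3_of_cleanLU3ZeroDim (cleanLU3_of_inputs …)` and ✓ `stub_cleanTwoModelPatching3` over the principalization node ✓
`stub_cleanPrincipalization3_of_cleanPermissiblePrincipalization (cleanPermissiblePrincipalization3_of_cleanProp44 h44c) stub_cleanPointBlowup` — fed
to the landed pointwise reduction ✓ `cleanModelsDimThree_of_logCleanPrincipalizationDimThree`.  Composition identical to the twin file's.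
[cite: CossartPiltant2019, Thm. 1.1] -/
theorem cleanModels_dimLEThree_of_inputs (h11 : CP2019.CossartPiltant2019Thm11.{0}) :
    ∀ p : ℕ, p.Prime → ∀ (k : Type) [Field k] [CharP k p] (W : AlgebraicGeometry.Scheme.{0}) [AlgebraicGeometry.IsIntegral W]
      (f : W ⟶ AlgebraicGeometry.Spec (.of k)) (L : Type) [Field L] [Algebra W.functionField L],
      AlgebraicGeometry.IsSeparated f → AlgebraicGeometry.LocallyOfFiniteType f → AlgebraicGeometry.QuasiCompact f →
      Literature.AlgebraicGeometry.Resolution.Scheme.IsRegular W → IsPurelyInseparable W.functionField L →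
      Module.finrank W.functionField L = p → topologicalKrullDim W ≤ 3 →
      ∃ (V : AlgebraicGeometry.Scheme.{0}) (π : V ⟶ W) (_ : AlgebraicGeometry.IsIntegral V) (_ : AlgebraicGeometry.IsDominant π),
        AlgebraicGeometry.IsProper π ∧ Literature.AlgebraicGeometry.Resolution.IsBirational π ∧
        Literature.AlgebraicGeometry.Resolution.Scheme.IsRegular V ∧ (∀ v : V, (∃ (y : L) (g : W.functionField),
          y ∉ Set.range (algebraMap W.functionField L) ∧ algebraMap W.functionField L g = y ^ p ∧
          ((∃ (d m : ℕ) (hmd : m ≤ d) (t : Fin d → V.presheaf.stalk v) (a : Fin m → ℕ),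
              Ideal.span (Set.range t) = IsLocalRing.maximalIdeal (V.presheaf.stalk v) ∧
              ringKrullDim (V.presheaf.stalk v) = (d : WithBot ℕ∞) ∧ 0 < m ∧ (∀ i, ¬ p ∣ a i) ∧
              Literature.AlgebraicGeometry.Motives.RatFn.functionFieldMap π g =
                ∏ i : Fin m, (algebraMap (V.presheaf.stalk v) V.functionField (t (Fin.castLE hmd i))) ^ (a i)) ∨
            (∃ u₀ : V.presheaf.stalk v, IsUnit u₀ ∧
              Literature.AlgebraicGeometry.Motives.RatFn.functionFieldMap π g = algebraMap (V.presheaf.stalk v) V.functionField u₀ ∧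
              ((∀ c : V.presheaf.stalk v, u₀ - c ^ p ∉ IsLocalRing.maximalIdeal (V.presheaf.stalk v)) ∨
                (∃ c : V.presheaf.stalk v, u₀ - c ^ p ∈ IsLocalRing.maximalIdeal (V.presheaf.stalk v) ∧
                  u₀ - c ^ p ∉ IsLocalRing.maximalIdeal (V.presheaf.stalk v) ^ 2)))))) := by
  intro p hp k _ _ W _ f L _ _ hs hl hq hr hpi hd h3
  by_cases h2 : topologicalKrullDim W ≤ 2
  · haveI := hs; haveI := hl; haveI := hq; haveI := hpi
    exact cleanModels_dimLETwo_of_f75c stub_stacks0BICLocus p hp k W f hr L hd h2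
  · exact cleanModelsDimThree_of_logCleanPrincipalizationDimThree
      (stub_cleanGlobalization3 (cleanCharts3_of_cleanLU3ZeroDim (cleanLU3_of_inputs (h112 := h112) (hBS2 := hBS2) (hB := hB) (h11 := h11)))
        (stub_cleanTwoModelPatching3
          (stub_cleanPrincipalization3_of_cleanPermissiblePrincipalization
            (cleanPermissiblePrincipalization3_of_cleanProp44 h44c) stub_cleanPointBlowup)))
      p hp k W f L hs hl hq hr hpi hd h2 h3

include h112 hBS2 hB h44c hGE4 in
/-- **The crux `Theses.RadicialJung.CleanModels` BY NAME from SIX inputs** (the hand-1 reshape of Sketch rev 35): THREE PRINTED facts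
(`CP2019.CossartPiltant2019Thm11` = CP 2019 Thm. 1.1 (i)(ii)(iii) verbatim, F-112 `Cossart1987Thm`, wi-91399 at `p = 2`), two RESEARCH statements
(`hB` class (B), `h44c` X44c) and the FRONTIER statement `hGE4` (`dim W ≥ 4`) — cases on `topologicalKrullDim W ≤ 3`.  A CONDITIONAL packaging of
the line's reduction, not a proof of the crux. [cite: CossartPiltant2019, Thm. 1.1] -/
theorem cleanModels_of_inputs (h11 : CP2019.CossartPiltant2019Thm11.{0}) :
    Summit.ResolutionOfSingularities.ResolutionOfSingularities.Theses.RadicialJung.CleanModels := by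
  intro p hp k _ _ W _ f L _ _ hs hl hq hr hpi hd
  by_cases h3 : topologicalKrullDim W ≤ 3
  · exact cleanModels_dimLEThree_of_inputs (h112 := h112) (hBS2 := hBS2) (hB := hB) (h44c := h44c) (h11 := h11) p hp k W f L hs hl hq hr hpi hd h3
  · exact hGE4 p hp k W f L hs hl hq hr hpi hd h3

include h112 hB h44c hGE4 in
/-- **The crux from THREE NAMED PRINTED FACTS** `CP2019.CossartPiltant2019Thm11` · `Cossart1987Thm` · `CossartPiltant2019_thm_1_5_i_baseSidePhase`
(wi-91399, every `p`; its `p = 2` instance is the registered stub, ✓ `Lens5.PTwo.baseSidePhaseTwo_of_cp2019`) and the three unproved statements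
`hB` / `h44c` / `hGE4` of ours. [cite: CossartPiltant2019, Thm. 1.1 and Thm. 1.5 (i)] -/
theorem cleanModels_of_namedInputs (h11 : CP2019.CossartPiltant2019Thm11.{0}) (hBS : CossartPiltant2019_thm_1_5_i_baseSidePhase.{0}) :
    Summit.ResolutionOfSingularities.ResolutionOfSingularities.Theses.RadicialJung.CleanModels :=
  cleanModels_of_inputs (h112 := h112) (hBS2 := Lens5.PTwo.baseSidePhaseTwo_of_cp2019 hBS) (hB := hB) (h44c := h44c)
    (hGE4 := hGE4) (h11 := h11)

include h112 hBS2 hB h44c hGE4 in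
/-- Book-keeping: the printed inputs of the registered rev-35 skeleton — CP 2019 Thm. 1.1 (i)(ii) AS PRINTED (`CossartPiltant2019General`)
and CJS 2020 Thm. 1.4 (`CossartJannsenSaito2020Embedded`, F-32) — also feed this composition, because the tree PROVES
`CP2019.thm11_of_general : CossartPiltant2019General → CossartJannsenSaito2020Embedded → CossartPiltant2019Thm11` (`GoodResolutionReduced2019.lean`).
So the re-accounting does not enlarge the printed base. [cite: CossartPiltant2019, Thm. 1.1] [cite: CossartJannsenSaito2020, Thm. 1.4, Cor. 1.5] -/
theorem cleanModels_of_general_cjs_inputs (hG : CossartPiltant2019General.{0}) (h32 : CossartJannsenSaito2020Embedded.{0}) :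
    Summit.ResolutionOfSingularities.ResolutionOfSingularities.Theses.RadicialJung.CleanModels :=
  cleanModels_of_inputs (h112 := h112) (hBS2 := hBS2) (hB := hB) (h44c := h44c) (hGE4 := hGE4)
    (h11 := CP2019.thm11_of_general hG h32)

end Inputs

end Summit.ResolutionOfSingularities.ResolutionOfSingularities.Theorems.RadicialJung.CleanModels.OfInputsThm11

end
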